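import Mathlib
import Literature.MathematicalPhysics.StatisticalMechanics.PeriodicConfigurationSums

/-!
# Crux `SpectralChargeLedger.SummedShellPricing` (K1, stmt-AtomisticToContinuum-17044), line `Sketch`,
# skeleton v3 — stub `stub_torusDivergence`: the torus divergence lemma

This file is stub `stub_torusDivergence` of line `Sketch` (skeleton v3,
`Cruxes/SummedShellPricing/Lines/Sketch.lean`) for crux stmt-AtomisticToContinuum-17044; it feeds
`interiorLedgerAt_of_calibration` there.  It is pure bookkeeping on periodic configurations (no
potential, no energy): **the divergence of an antisymmetric lattice-covariant `r⁻⁶` pair flux sums to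
zero over the motif of a periodic configuration** — for every periodic configuration `P` of `ℝ³` and
every `g : ℝ³ → ℝ³ → ℝ` with `g y z = -g z y`, `g (y + v) (z + v) = g y z` for all periods `v`, and
`|g y z| ≤ G·(dist y z)⁻⁶`,
`∑_{y ∈ motif} ∑'_{z ∈ points, z ≠ y} g y z = 0`.

Proof.  Every point of `P` is `m + λ` for a UNIQUE pair `(m, λ) ∈ motif × lattice` (distinct motif
points are inequivalent modulo the lattice, `PeriodicConfiguration.eq_of_sub_mem`), and `g y y = 0` by
antisymmetry, so for each `y` the inner sum is the sum of `g y (m + λ)` over ALL of `motif × lattice`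
(`tsum_motif_lattice_eq`).  The triple family `(y, m, λ) ↦ g y (m + λ)` on `motif × motif × lattice` is
absolutely summable (`|g| ≤ |G|·dist⁻⁶` and `∑_{λ} ‖λ − v‖⁻⁶ < ∞` on a rank-`3` lattice, Mathlib
`ZLattice.summable_norm_sub_inv_pow`; `summable_inv_pow_six_motif_lattice`), so the double sum is one
`tsum` over the triple product (`Summable.tsum_prod`), and the involution `(y, m, λ) ↦ (m, y, −λ)`
reverses the sign of every term (`g m (y − λ) = g (m + λ) y = −g y (m + λ)` by covariance and
antisymmetry); hence the sum equals its own negative (`Equiv.tsum_eq`, `tsum_neg`) and vanishes.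

Not here: anything about energies, the calibrated site inequality, the calibrated floor or the hub crux.
-/

noncomputable section

namespace Summit.AtomisticToContinuum.Crystallization.Theorems.SummedShellPricingTorusDivergence

open scoped BigOperators
open Literature.MathematicalPhysics.StatisticalMechanics

/-- **`dist⁻⁶` is summable over `motif × lattice`.**  For a periodic configuration `P` of `ℝ³` and any
centre `x`, `(m, λ) ↦ (dist x (m + λ))⁻⁶` is summable over `P.motif × P.lattice`: the motif is finite and
for each `m` the lattice sum `∑_{λ} ‖λ − (x − m)‖⁻⁶` converges because `6 > 3 = rank` (Mathlib
`ZLattice.summable_norm_sub_inv_pow`). [folklore] -/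
theorem summable_inv_pow_six_motif_lattice (P : PeriodicConfiguration 3) (x : EuclideanSpace ℝ (Fin 3)) :
    Summable fun p : P.motif × P.lattice => (dist x (p.1.1 + p.2.1))⁻¹ ^ 6 := by
  -- adapted from the proof of `PeriodicConfiguration.summable_inv_pow_dist`
  -- (Literature/MathematicalPhysics/StatisticalMechanics/PeriodicConfigurationSums.lean)
  refine (summable_prod_of_nonneg fun p => by positivity).2 ⟨fun z => ?_, .of_finite⟩
  have h := ZLattice.summable_norm_sub_inv_pow P.lattice 6
    (by rw [P.finrank_lattice]; norm_num) (x - z.1)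
  refine h.congr fun l => ?_
  simp only [dist_eq_norm]
  rw [show x - (z.1 + l.1) = -(l.1 - (x - z.1)) by abel, norm_neg]

/-- **Unique motif–lattice decomposition.**  For a periodic configuration `P`, the map
`(m, λ) ↦ m + λ` from `P.motif × P.lattice` to `ℝ³` is injective: distinct motif points are
inequivalent modulo the lattice (`PeriodicConfiguration.eq_of_sub_mem`). [folklore] -/
theorem motif_add_lattice_injective (P : PeriodicConfiguration 3) :
    Function.Injective fun p : P.motif × P.lattice => p.1.1 + p.2.1 := by
  rintro ⟨⟨m, hm⟩, ⟨l, hl⟩⟩ ⟨⟨m', hm'⟩, ⟨l', hl'⟩⟩ h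
  simp only at h
  have hml : m - m' = l' - l := by
    rw [sub_eq_sub_iff_add_eq_add, h, add_comm]
  have hmm' : m = m' := P.eq_of_sub_mem m hm m' hm' (hml ▸ P.lattice.sub_mem hl' hl)
  subst hmm'
  have hll' : l = l' := add_left_cancel h
  subst hll'
  rfl

/-- **Reindexing the punctured point sum over `motif × lattice`.**  If `g y y = 0`, then for a periodic
configuration `P` the sum of `z ↦ g y z` over the points `z ≠ y` of `P` equals the sum of
`(m, λ) ↦ g y (m + λ)` over all of `P.motif × P.lattice` (every point is uniquely `m + λ`, and the
possibly missing term `z = y` vanishes).  No summability is needed: both sides are `tsum`s of the same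
family up to an injective reindexing whose range contains the support. [folklore] -/
theorem tsum_motif_lattice_eq (P : PeriodicConfiguration 3) (g : EuclideanSpace ℝ (Fin 3) → ℝ)
    (y : EuclideanSpace ℝ (Fin 3)) (hgy : g y = 0) :
    ∑' z : {z // z ∈ P.points ∧ z ≠ y}, g z.1 = ∑' p : P.motif × P.lattice, g (p.1.1 + p.2.1) := by
  classical
  set s : Set (EuclideanSpace ℝ (Fin 3)) := {z | z ∈ P.points ∧ z ≠ y} with hs
  have h1 : ∑' z : {z // z ∈ P.points ∧ z ≠ y}, g z.1 = ∑' x, s.indicator g x := tsum_subtype s g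
  rw [h1]
  have hsupp : Function.support (s.indicator g) ⊆
      Set.range fun p : P.motif × P.lattice => p.1.1 + p.2.1 := by
    intro x hx
    have hx' : x ∈ s := Set.support_indicator_subset hx
    obtain ⟨m, hm, l, hl, rfl⟩ := hx'.1
    exact ⟨(⟨m, hm⟩, ⟨l, hl⟩), rfl⟩
  rw [← (motif_add_lattice_injective P).tsum_eq hsupp]
  refine tsum_congr fun p => ?_
  simp only [Set.indicator_apply]
  split_ifs with hp
  · rfl
  · -- `p.1 + p.2` is a point of `P`, so it is not in `s` only if it equals `y`
    have hmem : p.1.1 + p.2.1 ∈ P.points := ⟨p.1.1, p.1.2, p.2.1, p.2.2, rfl⟩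
    have hpy : p.1.1 + p.2.1 = y := by
      by_contra hne
      exact hp ⟨hmem, hne⟩
    rw [hpy, hgy]

/-- **Stub `stub_torusDivergence` (line `Sketch`, skeleton v3) — the torus divergence lemma.**  For a
periodic configuration `P` of `ℝ³` and a pair flux `g` which is antisymmetric (`g y z = -g z y`),
covariant under the period lattice (`g (y + v) (z + v) = g y z`, `v ∈ P.lattice`) and `r⁻⁶`-dominated
(`|g y z| ≤ G·(dist y z)⁻⁶`), the total divergence over the motif vanishes:
`∑_{y ∈ motif} ∑'_{z ∈ points, z ≠ y} g y z = 0`.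
Proof: every point is uniquely `m + λ` (`m ∈ motif`, `λ ∈ lattice`), the triple family
`(y, m, λ) ↦ g y (m + λ)` is absolutely summable, and the fixed-point-free involution
`(y, m, λ) ↦ (m, y, −λ)` reverses its sign (`g m (y − λ) = g (m + λ) y = −g y (m + λ)` by covariance and
antisymmetry), so the sum equals its own negative. [folklore] -/
theorem stub_torusDivergence :
    ∀ (P : PeriodicConfiguration 3) (g : EuclideanSpace ℝ (Fin 3) → EuclideanSpace ℝ (Fin 3) → ℝ) (G : ℝ),
      (∀ y z, g y z = -g z y) →
      (∀ v ∈ P.lattice, ∀ y z, g (y + v) (z + v) = g y z) →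
      (∀ y z, |g y z| ≤ G * (dist y z)⁻¹ ^ 6) →
      ∑ y ∈ P.motif, ∑' z : {z // z ∈ P.points ∧ z ≠ y}, g y z.1 = 0 := by
  intro P g G hanti hcov hbd
  classical
  -- the diagonal vanishes by antisymmetry
  have hdiag : ∀ y, g y y = 0 := fun y => by
    have h := hanti y y
    linarith
  -- the norm bound with `|G|` (valid whatever the sign of `G`)
  have hnorm : ∀ y z, ‖g y z‖ ≤ |G| * (dist y z)⁻¹ ^ 6 := fun y z => by
    rw [Real.norm_eq_abs]
    exact (hbd y z).trans (mul_le_mul_of_nonneg_right (le_abs_self G) (by positivity))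
  -- the triple family and its absolute summability
  set U : P.motif × (P.motif × P.lattice) → ℝ := fun t => g t.1.1 (t.2.1.1 + t.2.2.1) with hU
  have hUsum : Summable U := by
    have hD : Summable fun t : P.motif × (P.motif × P.lattice) =>
        |G| * (dist t.1.1 (t.2.1.1 + t.2.2.1))⁻¹ ^ 6 := by
      refine Summable.mul_left |G| ?_
      exact (summable_prod_of_nonneg fun t => by positivity).2
        ⟨fun y => summable_inv_pow_six_motif_lattice P y.1, .of_finite⟩
    exact Summable.of_norm_bounded hD fun t => hnorm _ _
  -- the double sum is the `tsum` of the triple family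
  have hS : ∑ y ∈ P.motif, ∑' z : {z // z ∈ P.points ∧ z ≠ y}, g y z.1 = ∑' t, U t := by
    rw [← Finset.tsum_subtype, hUsum.tsum_prod]
    refine tsum_congr fun y => ?_
    rw [tsum_motif_lattice_eq P (g y.1) y.1 (hdiag y.1)]
  -- the sign-reversing involution `(y, m, λ) ↦ (m, y, -λ)`
  let σ : P.motif × (P.motif × P.lattice) ≃ P.motif × (P.motif × P.lattice) :=
    { toFun := fun t => (t.2.1, (t.1, -t.2.2))
      invFun := fun t => (t.2.1, (t.1, -t.2.2))
      left_inv := fun t => by simp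
      right_inv := fun t => by simp }
  have hσ : ∀ t, U (σ t) = -U t := by
    rintro ⟨⟨y, hy⟩, ⟨m, hm⟩, ⟨l, hl⟩⟩
    simp only [hU, σ, Equiv.coe_fn_mk, Submodule.coe_neg]
    have h1 := hcov l hl m (y + -l)
    rw [neg_add_cancel_right] at h1
    rw [← h1, hanti (m + l) y]
  have hrev : ∑' t, U t = -∑' t, U t :=
    calc ∑' t, U t = ∑' t, U (σ t) := (Equiv.tsum_eq σ U).symm
      _ = ∑' t, -U t := tsum_congr hσ
      _ = -∑' t, U t := tsum_neg
  rw [hS]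
  linarith

end Summit.AtomisticToContinuum.Crystallization.Theorems.SummedShellPricingTorusDivergence

end
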